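/-
Copyright (c) 2026 the pub-hodgecm-mathlib formalisation cell (harness21).  Prover seat hodgecm-mathlib-LH4-p19 (g4), req620 Track A «(D-RAM) FOUR-FRAME» squad
(STAGE-1b, row (2) of the piece `f_{T₊}`, the (β₂) road (R-36) «PURE-CELL LEDGER»; lane-C RAY program v2-G8 of LH7-p10 (g3), row G6′ — the literal reads (hL₁)(hL₂) of the count socket
at an ARBITRARY digit-transfer radius `|jEϖ|^k`), 2026-09-05.
-/
import Summits.HodgeConjecture.HodgeConjecture.Theorems.F0P3cDyRamUpperRayCellReadsGen                 -- ★ p865054 G2 (this base, g3): `hjv`-only `exists_vertexFrame_of_gen`; brings ★ p864444 R1b-A, R1a, ★ p862869, ★ p864081, ★ `v_map_eq_one_iff`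
import Summits.HodgeConjecture.HodgeConjecture.Theorems.F0P3cDyRamDiagonalCellCleanRegime               -- ★ (LH4-p12): `v_map_le_pow_iff`
import Summits.HodgeConjecture.HodgeConjecture.Theorems.F0P3cDyRamRowCellGeneratorIndependenceRadius    -- ★ P6′ (LH7-p06 (g3)): `v_coord_sub_coord_le_of_gen_of_radius` (generator independence (hI) at radius `r`)
import HarnessLib

/-!
# Crux `H413`, line LH4 «(D-RAM) FOUR-FRAME» — STAGE-1b, row (2), the (β₂) road (R-36), (OFF) residue, RAY bands: «THE LITERAL READS OF AN UPPER-LINE RAY CELL AT AN ARBITRARY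
# DIGIT-TRANSFER RADIUS» — ★ p865085 `…UpperRayCellLiteralReadsGen.reads_of_gen6` with the radius letter `hrad` (resolution `k`) inserted and `hγr` read at `|ϖ|^k`; conclusion BYTE-IDENTICAL

Cell `hodgecm-mathlib` (D-0151), FLOOR 0, crux item H413 = `stmt-HodgeConjecture-24833`, route of record `HCCMUnconditional`; squad F0∕P3c∕LH4 (lane-C RAY port, LH7-p10 (g3)'s
LANEC-RAY-PROGRAM v2-G8 b4c9771c, row G6′); lane `--supports stmt-HodgeConjecture-24833 --as helper` (count-neutral; pays NO tier-0 row).  THEOREMS ONLY (no `def`, no instance, no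
notation, no `sorry`, default heartbeats); ★-only imports; states NO law; (β₂) stays a HYPOTHESIS.

WHY (LANEC-RAY-PROGRAM v2-G8 §0).  On the DIAGONAL cells of lane C's top line (`j + 1 = b + s0`) the reference pair has `|ξ₀|·|cc(α − ρα)| = |jEϖ|^{b−1}` (★ G1 `refPair_diag_sizes`), so
the generator-independence radius is the INTRINSIC one `|jEϖ|^{2b}∕(|ξ₀|·|cc|) = |jEϖ|^{b+1}` and the digit `γ₁` is one notch larger: the transfer of sphere and sign between the
coordinates of two generators must run at resolution `b + 1`, which ★ G6's fixed radius `|jEϖ|^b` (letters `hR` ⇒ (hI) at `|jEϖ|^b`, `hγr : |γ₁|·|ϖ|^b ≤ |ϖ|^{2d−1}`) cannot express.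
THIS FILE re-issues ★ G6 with the resolution as a PARAMETER `k`:
* the binders `{k : ℕ} (hrad : |jEϖ|^b·|jEϖ|^b ≤ |jEϖ|^k·(|ξ₀|·|cc(α − ρα)|))` are INSERTED right after `hR` (which stays: it feeds ★ G2 `exists_vertexFrame_of_gen`);
* `hγr` is READ AT `|ϖ|^k`: `(hγr : Valued.v γ₁ * Valued.v ϖ ^ k ≤ Valued.v ϖ ^ (2 * d - 1))` (same position);
* every other binder and the conclusion are ★ G6's, VERBATIM (binder ORDER kept).
Proof = ★ G6's with two lines changed: the transfer `htransfer` runs at `|jE V′ − jE V| ≤ |jEϖ|^k` (★ `v_map_le_pow_iff … k`, then `hγr`), and the nearness `hnear` of the two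
generators' coordinates is ★ P6′ `v_coord_sub_coord_le_of_gen_of_radius … hrad` (radius `r := |jEϖ|^k`).  ★ G6 is the instance `k := b` (`hR` ⇒ `hrad` at `k = b`); G8
(‹HU_RAY_C♮-diag›, LH7-p10) takes `k := b + 1`.
* HEAD `reads_of_gen6_of_radius`.
WHAT IS NOT CLAIMED: `hrad`, `hγr`, the reference pair, any count or census law — all stay HYPOTHESES of the consumer.
HONEST LABEL.  Count-neutral re-issue; nothing printed is asserted; no census law is stated; ‹HU_RAY_C♮-diag› and the lane-C letters stay OPEN; β₂ `stub_law_cleanSgn₂` UNPROVED;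
`HC_CM` is proved only modulo the 7 printed citations (2 remaining named inputs: hLiu418 = `stmt-HodgeConjecture-24832`, h413 = `stmt-HodgeConjecture-24833`) until rung 0 closes.
## References
* [Kottwitz1986BaseChangeUnits] R. E. Kottwitz, *Base change for unit elements of Hecke algebras*, Compositio Math. 60 (1986): §1 pp. 240–241, §3.
* [Jacobowitz1962] R. Jacobowitz, *Hermitian forms over local fields*, Amer. J. Math. 84 (1962): §4.
* [Rogawski1990] J. D. Rogawski, *Automorphic Representations of Unitary Groups in Three Variables*, Ann. of Math. Stud. 123 (1990): §4.9 Prop. 4.9.1 (b) p. 55, §12.2.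
* [Serre1979] J.-P. Serre, *Local Fields*, GTM 67 (1979): Ch. III §6 Prop. 12; Ch. V §3 Cor. 3; Ch. XV §2.
-/

set_option autoImplicit false

noncomputable section

namespace Summit.HodgeConjecture.HodgeConjecture.Cruxes.H413.F0P3cDyRamUpperRayCellLiteralReadsRadius

open scoped Valued WithZero Matrix MatrixGroups
open WithZero
open Literature.NumberTheory.Automorphic Literature.NumberTheory.Automorphic.HermitianLattice Literature.NumberTheory.Automorphic.UnitaryLatticeTree
open Literature.NumberTheory.Automorphic.UnitaryThreeFourFrame (IsRamifiedQuadraticDatum normSign)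
open Literature.NumberTheory.Rogawski1990
open Literature.NumberTheory.LocalFields.WildQuadraticDatum (normSign_eq_of_near)
open Summit.HodgeConjecture.HodgeConjecture.Cruxes.H413.F0P3cDyRamFourFramePieces
open Summit.HodgeConjecture.HodgeConjecture.Cruxes.H413.F0P3cDyRamFourFrameCensusDefs (LatticeInLevel)
open Summit.HodgeConjecture.HodgeConjecture.Cruxes.H413.F0P3cDyRamToricCensusDefs
open Summit.HodgeConjecture.HodgeConjecture.Cruxes.H413.F0P3cDyRamLabelShellFlipCardTwo (v_refSkew_eq)
open Summit.HodgeConjecture.HodgeConjecture.Cruxes.H413.F0P3cDyRamConeCellPresentation (exists_presentation_of_mem_levelSetDep)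
open Summit.HodgeConjecture.HodgeConjecture.Cruxes.H413.F0P3cDyRamConeCellGluedVertexExistsOfWeight (exists_glued_of_mem_levelSetDep_of_weight_ne_zero)
open Summit.HodgeConjecture.HodgeConjecture.Cruxes.H413.F0P3cDyRamRowCellGeneratorIndependenceRadius (v_coord_sub_coord_le_of_gen_of_radius)
open Summit.HodgeConjecture.HodgeConjecture.Cruxes.H413.F0P3cDyRamRowVertexPopulationRead (normSign_mul_eq_one_iff_eq)
open Summit.HodgeConjecture.HodgeConjecture.Cruxes.H413.F0P3cDyRamUpperRayVertexReads (exactLevel_iff_sphere valueSet_eq_xPlus_iff_sphereSign)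
open Summit.HodgeConjecture.HodgeConjecture.Cruxes.H413.F0P3cDyRamUpperRayCellReads (weight_ne_zero_iff_normSign_of_gen6)
open Summit.HodgeConjecture.HodgeConjecture.Cruxes.H413.F0P3cDyRamUpperRayCellReadsGen (exists_vertexFrame_of_gen)
open Summit.HodgeConjecture.HodgeConjecture.Cruxes.H413.F0P3cDyRamBoundaryCellLetterCardTwo (v_map_eq_one_iff)
open Summit.HodgeConjecture.HodgeConjecture.Cruxes.H413.F0P3cDyRamDiagonalCellCleanRegime (v_map_le_pow_iff)

variable {E M : Type} [Field E] [Valued E ℤᵐ⁰] [Field M] [Valued M ℤᵐ⁰] {ρ Θ : M →+* M} {α : M}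

/-- **HEAD — «THE LITERAL READS OF A POPULATED MEMBER OF AN UPPER-LINE RAY CELL, AT DIGIT-TRANSFER RADIUS `|jEϖ|^k`»** (★ p865085 `reads_of_gen6` with `{k} (hrad)` inserted after
`hR` and `hγr` read at `|ϖ|^k`; conclusion byte-identical).  Opened ‹OFF.letter.v2› letters (E-datum with `E` complete, `jE`-letters through `hjv`, the line model, the literal
`(H₂, h_W)`, the element `(γ₂, u)`, the weight letter `hf`) + the cell `(j, b)` (`1 ≤ b`, `d ≤ b`, `IsOrd(lam)`) + the CELL-LEVEL letters: the class letter `hFgap`; reference pair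
`κ₀, ξ₀` (`|κ₀| ≤ |ξ₀|`, `hR : |ϖE|^b ≤ |ξ₀|·|cc(α − ρα)|`) and the RADIUS letter `hrad : |jEϖ|^b·|jEϖ|^b ≤ |jEϖ|^k·(|ξ₀|·|cc(α − ρα)|)`; centre `W`, slope `B`, `P = (ϖσϖ)^b`
(`σP = P ≠ 0`), fixed `γ₁, W₁` with the SLOPE∕ROOT letters; the digit transfer AT RESOLUTION `k`: `|γ₁|·|ϖ|^k ≤ |ϖ|^{2d−1}`; the level letters at `ℓ₀ + 1` (`|u₀₀ − 1|`, `|lam − 1|`,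
`|lam − ρlam|`, `|μ|`); ray domination `μ = jEϖ^{m′}·μt`, `μt ∈ 𝒪_cc`, `m⋆ ≤ m′`; the deep tokens and the skew size at `n ≥ 3d − 2 + d%2`; `ρμ ≠ μ`.  THEN for every member `(Λ, x₀)`
with the six `GEN` clauses and `f b j Λ ≠ 0`:
`(∃ B, φ(B) = Λ ∧ ∃ L₃, SD ∧ L₃ ∩ W = ι_W B ∧ tube_b ∧ ((InLevel ℓ₀ ∧ ¬ InLevel (ℓ₀+1)) ∧ VS_{m⋆}(L₃) = VS(X₊))) ↔ ∃ Ve, jE Ve = Vf x₀ ∧ |γ₁(Ve − W₁)| = 1 ∧ ψ Ve`, and the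
same with `¬ (VS = VS(X₊))` ∕ `¬ ψ Ve`, where `Vf x₀ = (ρu₀∕t − κ₀)∕ξ₀`, `ψ Ve :≡ |γ₁(Ve − W₁)| = 1 → ω(γ₁(Ve − W₁)) = ω(−h_W)`.  (★ G6 = the instance `k := b`; the DIAGONAL
cells of lane C's top line take `k := b + 1`.)
[cite: Kottwitz1986BaseChangeUnits, §1 pp. 240–241] [cite: Jacobowitz1962, §4] [cite: Rogawski1990, §4.9 Prop. 4.9.1 (b) p. 55] [cite: Serre1979, Ch. V §3 Cor. 3; Ch. XV §2] -/
theorem reads_of_gen6_of_radius [CompleteSpace E] [IsDiscreteValuationRing 𝒪[E]] [Finite 𝓀[E]]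
    {σ : E →+* E} {ϖ : E} {d tE : ℕ} (hD : IsRamifiedQuadraticDatum σ ϖ d tE) (h2v : Valued.v (2 : E) < 1)
    (jE : E →+* M) (hjv : ∀ c, Valued.v (jE c) ≤ 1 ↔ Valued.v c ≤ 1) (hjfix : ∀ z, ρ z = z ↔ ∃ c, jE c = z) (hΘj : ∀ c, Θ (jE c) = jE (σ c))
    (hjpow : ∀ (t : E) (n : ℤ), Valued.v (jE t) = Valued.v (jE ϖ) ^ n ↔ Valued.v t = Valued.v ϖ ^ n)
    (hϖmax : ∀ t : M, ρ t = t → Valued.v t < 1 → Valued.v t ≤ Valued.v (jE ϖ))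
    (hρρ : ∀ x, ρ (ρ x) = x) (hvρ : ∀ x, Valued.v (ρ x) = Valued.v x) (hα : ρ α ≠ α) (hα1 : Valued.v α ≤ 1)
    (hint : ∀ z : M, Valued.v z ≤ 1 → Valued.v ((z - ρ z) / (α - ρ α)) ≤ 1)
    (hΘΘ : ∀ x, Θ (Θ x) = x) (hΘρ : ∀ x, Θ (ρ x) = ρ (Θ x)) (hvΘ : ∀ x, Valued.v (Θ x) = Valued.v x)
    {hM : M} (hΘh : Θ hM = hM) (hh : hM ≠ 0)
    {H₂ : Matrix (Fin 2) (Fin 2) E} (hH₂ : IsUnit H₂.det) (hH₂σ : (H₂.map σ)ᵀ = H₂) {hW : E} (hhW : Valued.v hW = 1) (hhWσ : σ hW = hW)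
    (φ : (Fin 2 → E) →+ M) (hφs : ∀ (c : E) (x : Fin 2 → E), φ (c • x) = jE c * φ x) (hφi : Function.Injective φ) (hφo : Function.Surjective φ)
    {γ₂ : GL (Fin 2) E} {lam : M} (hφγ : ∀ x, φ ((γ₂ : Matrix (Fin 2) (Fin 2) E).mulVec x) = lam * φ x) (hvlam : Valued.v lam = 1) (hΘlam : Θ lam * lam = 1)
    (hform : ∀ x y, jE (pairing σ H₂ x y) = hM * Θ (φ x) * φ y + ρ (hM * Θ (φ x) * φ y))
    (u : GL (Fin 1) E) (huu : ((u : Matrix (Fin 1) (Fin 1) E) 0 0) * σ ((u : Matrix (Fin 1) (Fin 1) E) 0 0) = 1)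
    {j b : ℕ} (hb1 : 1 ≤ b) (hdb : d ≤ b) (hcc : jE ϖ ^ j * (α - ρ α) ≠ 0) (hlamj : IsOrd ρ α (jE ϖ ^ j) lam)
    (f : ℕ → ℕ → AddSubgroup M → ℕ)
    (hf : ∀ (b j : ℕ) (Λ : AddSubgroup M) (x₀ : M) (r : E), 1 ≤ b → x₀ ≠ 0 →
      (∀ x, x ∈ Λ ↔ ∃ z, IsOrd ρ α (jE ϖ ^ j) z ∧ x = x₀ * z) →
      IsOrd ρ α (jE ϖ ^ j) (dualGen ρ Θ α (jE ϖ ^ j) hM x₀) → ¬ IsOrd ρ α (jE ϖ ^ j) (dualGen ρ Θ α (jE ϖ ^ j) hM x₀ / jE ϖ) →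
      Valued.v (dualGen ρ Θ α (jE ϖ ^ j) hM x₀) = Valued.v (jE ϖ) ^ b →
      (∀ b', (∀ x ∈ Λ, Valued.v (hM * Θ x * b' + ρ (hM * Θ x * b')) ≤ 1) → (lam - jE ((u : Matrix (Fin 1) (Fin 1) E) 0 0)) * b' ∈ Λ) →
      IsOrd ρ α (jE ϖ ^ j) lam → jE r = glueUnit ρ Θ α (jE ϖ ^ j) hM (jE ϖ) (jE hW) x₀ b →
      f b j Λ = Nat.card {x : 𝒪[E] ⧸ 𝓂[E] ^ (2 * b) // ∃ u' : 𝒪[E], Ideal.Quotient.mk (𝓂[E] ^ (2 * b)) u' = x ∧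
        Valued.v ((u' : E) * σ u' - r) ≤ Valued.v (ϖ ^ (2 * b))})
    -- cell-level letters
    (hFgap : ∀ z : M, ρ z = z → Θ z = z → Valued.v (jE ϖ) < Valued.v z → Valued.v z ≤ 1 → Valued.v z = 1)
    {κ₀ ξ₀ : M} (hκ₀ : κ₀ + ρ κ₀ = 1) (hΘκ₀ : Θ κ₀ = κ₀) (hξ : ρ ξ₀ = -ξ₀) (hΘξ : Θ ξ₀ = ξ₀) (hξ0 : ξ₀ ≠ 0)
    (hκ₀v : Valued.v κ₀ ≤ Valued.v ξ₀) (hR : Valued.v (jE ϖ) ^ b ≤ Valued.v ξ₀ * Valued.v (jE ϖ ^ j * (α - ρ α)))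
    {k : ℕ} (hrad : Valued.v (jE ϖ) ^ b * Valued.v (jE ϖ) ^ b ≤ Valued.v (jE ϖ) ^ k * (Valued.v ξ₀ * Valued.v (jE ϖ ^ j * (α - ρ α))))
    {W BE P γ₁ W₁ : E}
    (hWc : jE W * ξ₀ = ρ (lam - jE ((u : Matrix (Fin 1) (Fin 1) E) 0 0)) / (ρ (lam - jE ((u : Matrix (Fin 1) (Fin 1) E) 0 0)) - (lam - jE ((u : Matrix (Fin 1) (Fin 1) E) 0 0))) - κ₀)
    (hBE : jE BE = ((lam - jE ((u : Matrix (Fin 1) (Fin 1) E) 0 0)) - ρ (lam - jE ((u : Matrix (Fin 1) (Fin 1) E) 0 0))) * ξ₀)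
    (hP0 : P ≠ 0) (hσP : σ P = P) (hPb : P = (ϖ * σ ϖ) ^ b) (hσγ : σ γ₁ = γ₁) (hσW₁ : σ W₁ = W₁)
    (hθ : Valued.v (BE / (P * ((ϖ - σ ϖ) * ((ϖ * σ ϖ) ^ ((d - d % 2) / 2))⁻¹)) - γ₁) ≤ Valued.v γ₁ * Valued.v ϖ ^ (2 * d - 1))
    (hWW : Valued.v (γ₁ * (W - W₁)) ≤ Valued.v ϖ ^ (2 * d - 1))
    (hγr : Valued.v γ₁ * Valued.v ϖ ^ k ≤ Valued.v ϖ ^ (2 * d - 1))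
    (hul : Valued.v ((u : Matrix (Fin 1) (Fin 1) E) 0 0 - 1) ≤ Valued.v (ϖ ^ (d % 2 + 1)))
    (hlam1 : Valued.v (lam - 1) ≤ Valued.v (jE ϖ) ^ (d % 2 + 1))
    (hlamρ : Valued.v (lam - ρ lam) ≤ Valued.v (jE ϖ ^ j * (α - ρ α)) * Valued.v (jE ϖ) ^ (d % 2 + 1))
    (hμl : Valued.v (lam - jE ((u : Matrix (Fin 1) (Fin 1) E) 0 0)) ≤ Valued.v (jE ϖ) ^ (d % 2 + 1) * Valued.v (jE ϖ) ^ b)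
    {μt : M} {m' : ℕ} (hμ : lam - jE ((u : Matrix (Fin 1) (Fin 1) E) 0 0) = jE (ϖ ^ m') * μt) (hμt : IsOrd ρ α (jE ϖ ^ j) μt) (hmm : mstarOfRecord d ≤ m')
    {n : ℕ} (hn : 3 * d - 2 + d % 2 ≤ n)
    (hlamn : Valued.v (lam - 1) ≤ Valued.v (jE ϖ) ^ n) (hun : Valued.v ((u : Matrix (Fin 1) (Fin 1) E) 0 0 - 1) ≤ Valued.v ϖ ^ n)
    (hskb : Valued.v (lam - jE ((u : Matrix (Fin 1) (Fin 1) E) 0 0)) * Valued.v (lam - ρ lam) ≤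
      Valued.v (jE ϖ) ^ n * Valued.v (jE ϖ ^ j * (α - ρ α)) * Valued.v (jE ϖ) ^ b)
    (hμρ : ρ (lam - jE ((u : Matrix (Fin 1) (Fin 1) E) 0 0)) ≠ lam - jE ((u : Matrix (Fin 1) (Fin 1) E) 0 0))
    (Λ : AddSubgroup M) (x₀ : M)
    (hG : x₀ ≠ 0 ∧ (∀ x, x ∈ Λ ↔ ∃ ζ, IsOrd ρ α (jE ϖ ^ j) ζ ∧ x = x₀ * ζ) ∧
      IsOrd ρ α (jE ϖ ^ j) (dualGen ρ Θ α (jE ϖ ^ j) hM x₀) ∧ ¬ IsOrd ρ α (jE ϖ ^ j) (dualGen ρ Θ α (jE ϖ ^ j) hM x₀ / jE ϖ) ∧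
      Valued.v (dualGen ρ Θ α (jE ϖ ^ j) hM x₀) = Valued.v (jE ϖ) ^ b ∧
      (∀ b', (∀ x ∈ Λ, Valued.v (hM * Θ x * b' + ρ (hM * Θ x * b')) ≤ 1) → (lam - jE ((u : Matrix (Fin 1) (Fin 1) E) 0 0)) * b' ∈ Λ))
    (hfne : f b j Λ ≠ 0) :
    ((∃ B : Submodule 𝒪[E] (Fin 2 → E), B.toAddSubgroup.map φ = Λ ∧
        ∃ L₃ : Submodule 𝒪[E] (Fin 3 → E), IsSelfDualLattice σ ϖ (!![H₂ 0 0, 0, H₂ 0 1; 0, hW, 0; H₂ 1 0, 0, H₂ 1 1] : Matrix (Fin 3) (Fin 3) E) L₃ ∧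
          L₃ ⊓ LinearMap.ker ((LinearMap.proj (1 : Fin 3) : (Fin 3 → E) →ₗ[E] E).restrictScalars 𝒪[E]) =
            B.map ((Matrix.toLin' (!![1, 0; 0, 0; 0, 1] : Matrix (Fin 3) (Fin 2) E)).restrictScalars 𝒪[E]) ∧
          (∀ c : E, (Pi.single 1 c : Fin 3 → E) ∈ L₃ ↔ Valued.v c ≤ Valued.v ϖ ^ b) ∧
          ((LatticeInLevel ϖ (d % 2) ((((endoGL (γ₂, u) : GL (Fin 3) E) : Matrix (Fin 3) (Fin 3) E) - 1)) L₃ ∧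
              ¬ LatticeInLevel ϖ (d % 2 + 1) ((((endoGL (γ₂, u) : GL (Fin 3) E) : Matrix (Fin 3) (Fin 3) E) - 1)) L₃) ∧
            {z : E | ∃ y ∈ L₃, Valued.v ((ϖ ^ (mstarOfRecord d))⁻¹ * (z - pairing σ (!![H₂ 0 0, 0, H₂ 0 1; 0, hW, 0; H₂ 1 0, 0, H₂ 1 1] : Matrix (Fin 3) (Fin 3) E) y
                (((((endoGL (γ₂, u) : GL (Fin 3) E) : Matrix (Fin 3) (Fin 3) E) - 1)) *ᵥ y))) ≤ 1} = valueSetMod σ ϖ (mstarOfRecord d) (xPlus σ ϖ d))) ↔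
      ∃ Ve : E, jE Ve = (ρ (hM * (x₀ * Θ x₀)) / (hM * (x₀ * Θ x₀) + ρ (hM * (x₀ * Θ x₀))) - κ₀) / ξ₀ ∧ Valued.v (γ₁ * (Ve - W₁)) = 1 ∧
        (Valued.v (γ₁ * (Ve - W₁)) = 1 → normSign σ (γ₁ * (Ve - W₁)) = normSign σ (-hW))) ∧
    ((∃ B : Submodule 𝒪[E] (Fin 2 → E), B.toAddSubgroup.map φ = Λ ∧
        ∃ L₃ : Submodule 𝒪[E] (Fin 3 → E), IsSelfDualLattice σ ϖ (!![H₂ 0 0, 0, H₂ 0 1; 0, hW, 0; H₂ 1 0, 0, H₂ 1 1] : Matrix (Fin 3) (Fin 3) E) L₃ ∧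
          L₃ ⊓ LinearMap.ker ((LinearMap.proj (1 : Fin 3) : (Fin 3 → E) →ₗ[E] E).restrictScalars 𝒪[E]) =
            B.map ((Matrix.toLin' (!![1, 0; 0, 0; 0, 1] : Matrix (Fin 3) (Fin 2) E)).restrictScalars 𝒪[E]) ∧
          (∀ c : E, (Pi.single 1 c : Fin 3 → E) ∈ L₃ ↔ Valued.v c ≤ Valued.v ϖ ^ b) ∧
          ((LatticeInLevel ϖ (d % 2) ((((endoGL (γ₂, u) : GL (Fin 3) E) : Matrix (Fin 3) (Fin 3) E) - 1)) L₃ ∧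
              ¬ LatticeInLevel ϖ (d % 2 + 1) ((((endoGL (γ₂, u) : GL (Fin 3) E) : Matrix (Fin 3) (Fin 3) E) - 1)) L₃) ∧
            ¬ {z : E | ∃ y ∈ L₃, Valued.v ((ϖ ^ (mstarOfRecord d))⁻¹ * (z - pairing σ (!![H₂ 0 0, 0, H₂ 0 1; 0, hW, 0; H₂ 1 0, 0, H₂ 1 1] : Matrix (Fin 3) (Fin 3) E) y
                (((((endoGL (γ₂, u) : GL (Fin 3) E) : Matrix (Fin 3) (Fin 3) E) - 1)) *ᵥ y))) ≤ 1} = valueSetMod σ ϖ (mstarOfRecord d) (xPlus σ ϖ d))) ↔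
      ∃ Ve : E, jE Ve = (ρ (hM * (x₀ * Θ x₀)) / (hM * (x₀ * Θ x₀) + ρ (hM * (x₀ * Θ x₀))) - κ₀) / ξ₀ ∧ Valued.v (γ₁ * (Ve - W₁)) = 1 ∧
        ¬ (Valued.v (γ₁ * (Ve - W₁)) = 1 → normSign σ (γ₁ * (Ve - W₁)) = normSign σ (-hW))) := by
  obtain ⟨hσσ, hvσ, hϖ, -, hd, hd1, -⟩ := id hD
  have hvϖ0 : Valued.v ϖ ≠ 0 := by rw [hϖ]; exact exp_ne_zero
  have hϖ0 : ϖ ≠ 0 := fun h0 => hvϖ0 (by rw [h0, map_zero])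
  have hϖlt : Valued.v ϖ < 1 := by rw [hϖ, ← exp_zero, exp_lt_exp]; norm_num
  have hϖ1 : Valued.v ϖ ≤ 1 := hϖlt.le
  have hjϖ0 : jE ϖ ≠ 0 := (map_ne_zero jE).2 hϖ0
  have hvjϖ0 : Valued.v (jE ϖ) ≠ 0 := (Valuation.ne_zero_iff _).2 hjϖ0
  have hjϖ1 : Valued.v (jE ϖ) ≤ 1 := (hjv ϖ).2 hϖ1
  have hρj : ∀ c : E, ρ (jE c) = jE c := fun c => (hjfix _).2 ⟨c, rfl⟩
  have hc : ρ (jE ϖ ^ j) = jE ϖ ^ j := by rw [map_pow, hρj]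
  have hc0 : jE ϖ ^ j ≠ 0 := pow_ne_zero _ hjϖ0
  have hc1 : Valued.v (jE ϖ ^ j) ≤ 1 := by rw [Valuation.map_pow]; exact pow_le_one₀ zero_le hjϖ1
  have hhW1 : Valued.v (jE hW) = 1 := (v_map_eq_one_iff jE hjv hW).2 hhW
  have hsmall : Valued.v ϖ ^ (2 * d - 1) < 1 := pow_lt_one₀ zero_le hϖlt (by omega)
  have hYbpos : (0 : ℤᵐ⁰) < Valued.v (jE ϖ) ^ b := pow_pos (zero_lt_iff.2 hvjϖ0) _
  set μ : M := lam - jE ((u : Matrix (Fin 1) (Fin 1) E) 0 0) with hμdef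
  set H : Matrix (Fin 3) (Fin 3) E := !![H₂ 0 0, 0, H₂ 0 1; 0, hW, 0; H₂ 1 0, 0, H₂ 1 1] with hHdef
  set tp : E := (ϖ - σ ϖ) * ((ϖ * σ ϖ) ^ ((d - d % 2) / 2))⁻¹ with htpdef
  obtain ⟨hx₀, hΛx, hyO, hyprim, hylev, hdep⟩ := hG
  have hG5 : x₀ ≠ 0 ∧ (∀ x, x ∈ Λ ↔ ∃ ζ, IsOrd ρ α (jE ϖ ^ j) ζ ∧ x = x₀ * ζ) ∧
      IsOrd ρ α (jE ϖ ^ j) (dualGen ρ Θ α (jE ϖ ^ j) hM x₀) ∧ ¬ IsOrd ρ α (jE ϖ ^ j) (dualGen ρ Θ α (jE ϖ ^ j) hM x₀ / jE ϖ) ∧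
      Valued.v (dualGen ρ Θ α (jE ϖ ^ j) hM x₀) = Valued.v (jE ϖ) ^ b := ⟨hx₀, hΛx, hyO, hyprim, hylev⟩
  have hΛmem : Λ ∈ levelSetDep ρ Θ α (jE ϖ) hM j b μ := ⟨⟨x₀, hx₀, hΛx, hyO, hyprim, hylev⟩, hdep⟩
  -- the frame of `x₀` itself
  obtain ⟨w₀, V, hw₀Y, hσV, -, hjV, -, -, -⟩ := exists_vertexFrame_of_gen (α := α) hD jE hjv hjfix hΘj hρρ hvρ hΘΘ hΘρ hvΘ hΘh hh hH₂σ φ hφo hform hb1 hcc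
    hFgap hκ₀ hΘκ₀ hξ hΘξ hξ0 hκ₀v hR Λ x₀ hG5
  -- strict forms of the slope and root letters
  have htp0 : tp ≠ 0 := fun h00 => by
    have e := v_refSkew_eq hvσ hϖ hd
    rw [← htpdef, h00, map_zero] at e; exact pow_ne_zero _ hvϖ0 e.symm
  have hγ0 : γ₁ ≠ 0 := by
    intro h0
    rw [h0, Valuation.map_zero, zero_mul, sub_zero] at hθ
    have hq : BE / (P * tp) = 0 := (Valuation.zero_iff _).1 (le_antisymm hθ zero_le)
    have hBE0 : BE = 0 := by rwa [div_eq_zero_iff, or_iff_left (mul_ne_zero hP0 htp0)] at hq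
    have : (μ - ρ μ) * ξ₀ = 0 := by rw [← hBE, hBE0, map_zero]
    exact mul_ne_zero (sub_ne_zero.2 (Ne.symm hμρ)) hξ0 this
  have hγpos : (0 : ℤᵐ⁰) < Valued.v γ₁ := zero_lt_iff.2 ((Valuation.ne_zero_iff _).2 hγ0)
  have hθlt : Valued.v (BE / (P * tp) - γ₁) < Valued.v γ₁ :=
    hθ.trans_lt (by
      calc Valued.v γ₁ * Valued.v ϖ ^ (2 * d - 1) < Valued.v γ₁ * 1 := mul_lt_mul_of_pos_left hsmall hγpos
        _ = Valued.v γ₁ := mul_one _)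
  have hWlt : Valued.v (γ₁ * (W - W₁)) < 1 := hWW.trans_lt hsmall
  -- transfer of sphere and sign between two fixed coordinates within `|ϖ|^k`
  have htransfer : ∀ V' : E, σ V' = V' → Valued.v (jE V' - jE V) ≤ Valued.v (jE ϖ) ^ k →
      (Valued.v (γ₁ * (V' - W₁)) = 1 ↔ Valued.v (γ₁ * (V - W₁)) = 1) ∧
      (Valued.v (γ₁ * (V - W₁)) = 1 → normSign σ (γ₁ * (V' - W₁)) = normSign σ (γ₁ * (V - W₁))) := by
    intro V' hσV' hnear
    have hVVb : Valued.v (V' - V) ≤ Valued.v ϖ ^ k := (v_map_le_pow_iff jE hjv hϖ0 (V' - V) k).1 (by rw [map_sub]; exact hnear)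
    have hVV : Valued.v (γ₁ * (V' - V)) ≤ Valued.v ϖ ^ (2 * d - 1) := by
      rw [Valuation.map_mul]
      calc Valued.v γ₁ * Valued.v (V' - V) ≤ Valued.v γ₁ * Valued.v ϖ ^ k := mul_le_mul' le_rfl hVVb
        _ ≤ Valued.v ϖ ^ (2 * d - 1) := hγr
    have hVVlt : Valued.v (γ₁ * (V' - V)) < 1 := hVV.trans_lt hsmall
    have hsph : Valued.v (γ₁ * (V' - W₁)) = 1 ↔ Valued.v (γ₁ * (V - W₁)) = 1 := by
      have e1 : γ₁ * (V' - W₁) = γ₁ * (V - W₁) + γ₁ * (V' - V) := by ring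
      have e2 : γ₁ * (V - W₁) = γ₁ * (V' - W₁) - γ₁ * (V' - V) := by ring
      constructor
      · intro h1; rw [e2, Valuation.map_sub_eq_of_lt_left _ (by rw [h1]; exact hVVlt), h1]
      · intro h1; rw [e1, Valuation.map_add_eq_of_lt_left _ (by rw [h1]; exact hVVlt), h1]
    refine ⟨hsph, fun h1 => ?_⟩
    have hσg : σ (γ₁ * (V - W₁)) = γ₁ * (V - W₁) := by rw [map_mul, map_sub, hσγ, hσV, hσW₁]
    have hσg' : σ (γ₁ * (V' - W₁)) = γ₁ * (V' - W₁) := by rw [map_mul, map_sub, hσγ, hσV', hσW₁]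
    refine normSign_eq_of_near hD hσg hσg' h1 (n := 2 * d - 1) le_rfl ?_
    have e : γ₁ * (V - W₁) - γ₁ * (V' - W₁) = -(γ₁ * (V' - V)) := by ring
    rw [e, Valuation.map_neg]; exact hVV
  -- KEY: the two reads of ANY glued vertex over `Λ`, expressed at the coordinate `V` of `x₀`
  have key : ∀ (B : Submodule 𝒪[E] (Fin 2 → E)) (L₃ : Submodule 𝒪[E] (Fin 3 → E)), B.toAddSubgroup.map φ = Λ → IsSelfDualLattice σ ϖ H L₃ →
      L₃ ⊓ LinearMap.ker ((LinearMap.proj (1 : Fin 3) : (Fin 3 → E) →ₗ[E] E).restrictScalars 𝒪[E]) =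
        B.map ((Matrix.toLin' (!![1, 0; 0, 0; 0, 1] : Matrix (Fin 3) (Fin 2) E)).restrictScalars 𝒪[E]) →
      (∀ c : E, (Pi.single 1 c : Fin 3 → E) ∈ L₃ ↔ Valued.v c ≤ Valued.v ϖ ^ b) →
      ((LatticeInLevel ϖ (d % 2) ((((endoGL (γ₂, u) : GL (Fin 3) E) : Matrix (Fin 3) (Fin 3) E) - 1)) L₃ ∧
          ¬ LatticeInLevel ϖ (d % 2 + 1) ((((endoGL (γ₂, u) : GL (Fin 3) E) : Matrix (Fin 3) (Fin 3) E) - 1)) L₃) ↔ Valued.v (γ₁ * (V - W₁)) = 1) ∧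
      (Valued.v (γ₁ * (V - W₁)) = 1 →
        ({z : E | ∃ y ∈ L₃, Valued.v ((ϖ ^ (mstarOfRecord d))⁻¹ * (z - pairing σ H y (((((endoGL (γ₂, u) : GL (Fin 3) E) : Matrix (Fin 3) (Fin 3) E) - 1)) *ᵥ y))) ≤ 1} =
            valueSetMod σ ϖ (mstarOfRecord d) (xPlus σ ϖ d) ↔ normSign σ (γ₁ * (V - W₁)) = normSign σ (-hW))) := by
    intro B L₃ hBΛ hSD hLB htube
    obtain ⟨x₁, w₁, g₁, hx₁, hΛx₁, hyO₁, hyp₁, hylev₁, hw₁Y, hpr, hg₁, hg₁1, hprg⟩ :=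
      exists_presentation_of_mem_levelSetDep σ hσσ hvσ hϖ hH₂ hH₂σ hhW jE hρρ hvρ hα hα1 hint hΘΘ hΘρ hvΘ hjv hjfix hjpow hϖmax φ hφs hφi hφo hφγ hvlam
        hΘh hh hform ((u : Matrix (Fin 1) (Fin 1) E) 0 0) hb1 hlamj hΛmem hBΛ hSD hLB htube
    have hG5₁ : x₁ ≠ 0 ∧ (∀ x, x ∈ Λ ↔ ∃ ζ, IsOrd ρ α (jE ϖ ^ j) ζ ∧ x = x₁ * ζ) ∧
        IsOrd ρ α (jE ϖ ^ j) (dualGen ρ Θ α (jE ϖ ^ j) hM x₁) ∧ ¬ IsOrd ρ α (jE ϖ ^ j) (dualGen ρ Θ α (jE ϖ ^ j) hM x₁ / jE ϖ) ∧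
        Valued.v (dualGen ρ Θ α (jE ϖ ^ j) hM x₁) = Valued.v (jE ϖ) ^ b := ⟨hx₁, hΛx₁, hyO₁, hyp₁, hylev₁⟩
    -- the frame at the presentation generator `x₁` (its plane vector is `w₁`, by injectivity of `φ`)
    obtain ⟨w₁', V₁, hw₁'Y, hσV₁, -, hjV₁, hκ₁, hσpw₁, hpwP₁⟩ := exists_vertexFrame_of_gen (α := α) hD jE hjv hjfix hΘj hρρ hvρ hΘΘ hΘρ hvΘ hΘh hh hH₂σ φ
      hφo hform hb1 hcc hFgap hκ₀ hΘκ₀ hξ hΘξ hξ0 hκ₀v hR Λ x₁ hG5₁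
    have hww : w₁' = w₁ := hφi (by rw [hw₁'Y, hw₁Y])
    subst hww
    -- generator independence at radius `|jEϖ|^k` (★ P6′): the two coordinates are `|ϖ|^k`-close, so sphere and sign transfer
    have hnear : Valued.v (jE V₁ - jE V) ≤ Valued.v (jE ϖ) ^ k := by
      rw [hjV₁, hjV]
      exact v_coord_sub_coord_le_of_gen_of_radius jE hjfix hjϖ0 hjϖ1 hρρ hvρ hΘΘ hΘρ hvΘ hΘh hb1 hcc hFgap κ₀ hξ0 hrad Λ x₀ x₁ hG5 hG5₁
    obtain ⟨hsphT, hsignT⟩ := htransfer V₁ hσV₁ hnear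
    have hY₁0 : dualGen ρ Θ α (jE ϖ ^ j) hM x₁ ≠ 0 := fun h0 => by
      rw [h0, map_zero] at hylev₁; exact (pow_ne_zero _ hvjϖ0) hylev₁.symm
    have hpwP₁' : Valued.v (pairing σ H₂ w₁' w₁' * P) = 1 := by rw [hPb]; exact hpwP₁
    have hμl₁ : Valued.v μ ≤ Valued.v (jE ϖ ^ (d % 2 + 1) * dualGen ρ Θ α (jE ϖ ^ j) hM x₁) := by
      rw [Valuation.map_mul, hylev₁, map_pow]; exact hμl
    -- exact level ↔ sphere (★ R1a HEAD 1 at `x₁`), then transfer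
    have hex := exactLevel_iff_sphere hρρ hvρ hΘΘ hΘρ hvΘ hvσ hϖ hd jE hjv hjfix H₂ φ hφs hφi hφγ hΘh hh hform htube hpr hLB.symm hg₁ hg₁1 hprg hBΛ hcc
      hx₁ hY₁0 hΛx₁ hw₁Y u hul hlam1 hlamρ hμl₁ hμρ hκ₁ hWc hBE hP0 hpwP₁' hθlt hWlt
    refine ⟨hex.trans hsphT, fun hNX => ?_⟩
    have hsph₁ : Valued.v (γ₁ * (V₁ - W₁)) = 1 := hsphT.2 hNX
    -- the label (★ R1a HEAD 2 at `x₁`): integral pairing on `L₃`, depth token, skew size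
    have hintL : ∀ y ∈ L₃, Valued.v (pairing σ H y y) ≤ 1 := fun y hy =>
      (mem_dualLatt σ H L₃ y).1 (le_dualLatt_of_isVertexLattice hvσ hSD hy) y hy
    have hP₁ : IsOrd ρ α (jE ϖ ^ j) (μ / dualGen ρ Θ α (jE ϖ ^ j) hM x₁) :=
      (forall_herm_mul_mem_iff_isOrd_div hρρ hvρ hα hα1 hint hΘΘ hΘρ hvΘ hc hc0 hc1 hh hx₁ hΛx₁ μ).1 hdep
    have hsk₁ : Valued.v (μ / dualGen ρ Θ α (jE ϖ ^ j) hM x₁) * Valued.v (lam - ρ lam) ≤ Valued.v (jE ϖ) ^ n * Valued.v (jE ϖ ^ j * (α - ρ α)) := by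
      rw [map_div₀, hylev₁, div_mul_eq_mul_div, div_le_iff₀ hYbpos]; exact hskb
    have hVS := valueSet_eq_xPlus_iff_sphereSign (α := α) hD H₂ hW jE hjv hjfix hρρ hvρ hα hα1 hint hΘΘ hΘρ hvΘ hΘj φ hφs hφγ hh hΘh hform hpr hintL hLB.symm
      hg₁ hg₁1 hprg u hc hc0 hc1 hcc hx₁ hBΛ hΛx₁ hw₁Y hyO₁ hμ hμt hmm hΘlam hvlam huu hP₁ hn hlamn hun hsk₁ hμρ hσV₁ hκ₁ hWc hBE hP0 hσP hσpw₁ hpwP₁' hσγ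
      hσW₁ hθ hWW hsph₁
    -- the population sign at `x₁` (★ R1b-A §3)
    have hs₁ : normSign σ (pairing σ H₂ w₁' w₁' * P) = normSign σ (-hW) := by
      rw [hPb]
      exact (weight_ne_zero_iff_normSign_of_gen6 hD h2v jE hjv hjfix hΘj hρρ hvρ hΘΘ hΘρ hvΘ hΘh hh φ hform hb1 hdb hcc hFgap hhWσ hhW1 hlamj f hf Λ x₁
        ⟨hx₁, hΛx₁, hyO₁, hyp₁, hylev₁, hdep⟩ hw₁Y).1 hfne
    rw [hVS, normSign_mul_eq_one_iff_eq hs₁, hsignT hNX]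
  -- `jE` is injective: the coordinate is pinned
  have hVf : ∀ Ve : E, jE Ve = (ρ (hM * (x₀ * Θ x₀)) / (hM * (x₀ * Θ x₀) + ρ (hM * (x₀ * Θ x₀))) - κ₀) / ξ₀ → Ve = V :=
    fun Ve h1 => jE.injective (h1.trans hjV.symm)
  refine ⟨⟨?_, ?_⟩, ⟨?_, ?_⟩⟩
  · rintro ⟨B, hBΛ, L₃, hSD, hLB, htube, hexa, hVSa⟩
    obtain ⟨hexi, hsgi⟩ := key B L₃ hBΛ hSD hLB htube
    have hNX := hexi.1 hexa
    exact ⟨V, hjV, hNX, fun _ => (hsgi hNX).1 hVSa⟩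
  · rintro ⟨Ve, hjVe, hNX, hψ⟩
    have hVe := hVf Ve hjVe
    subst Ve
    obtain ⟨B, hBΛ, L₃, hSD, hLB, htube⟩ := exists_glued_of_mem_levelSetDep_of_weight_ne_zero σ hσσ hvσ hϖ hH₂ hH₂σ hhW hhWσ jE hρρ hvρ hα hα1 hint hΘΘ hΘρ
      hvΘ hΘj hjv hjfix hjpow hϖmax φ hφs hφi hφo hφγ hvlam hΘh hh hform ((u : Matrix (Fin 1) (Fin 1) E) 0 0) hb1 hlamj f hf hΛmem hfne
    obtain ⟨hexi, hsgi⟩ := key B L₃ hBΛ hSD hLB htube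
    exact ⟨B, hBΛ, L₃, hSD, hLB, htube, hexi.2 hNX, (hsgi hNX).2 (hψ hNX)⟩
  · rintro ⟨B, hBΛ, L₃, hSD, hLB, htube, hexa, hVSa⟩
    obtain ⟨hexi, hsgi⟩ := key B L₃ hBΛ hSD hLB htube
    have hNX := hexi.1 hexa
    exact ⟨V, hjV, hNX, fun hψ => hVSa ((hsgi hNX).2 (hψ hNX))⟩
  · rintro ⟨Ve, hjVe, hNX, hψ⟩
    have hVe := hVf Ve hjVe
    subst Ve
    obtain ⟨B, hBΛ, L₃, hSD, hLB, htube⟩ := exists_glued_of_mem_levelSetDep_of_weight_ne_zero σ hσσ hvσ hϖ hH₂ hH₂σ hhW hhWσ jE hρρ hvρ hα hα1 hint hΘΘ hΘρ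
      hvΘ hΘj hjv hjfix hjpow hϖmax φ hφs hφi hφo hφγ hvlam hΘh hh hform ((u : Matrix (Fin 1) (Fin 1) E) 0 0) hb1 hlamj f hf hΛmem hfne
    obtain ⟨hexi, hsgi⟩ := key B L₃ hBΛ hSD hLB htube
    exact ⟨B, hBΛ, L₃, hSD, hLB, htube, hexi.2 hNX, fun hVSa => hψ fun _ => (hsgi hNX).1 hVSa⟩

end Summit.HodgeConjecture.HodgeConjecture.Cruxes.H413.F0P3cDyRamUpperRayCellLiteralReadsRadius

end
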